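import Summits.HubbardSuperconductivity.HubbardSuperconductivity.Theorems.AnisotropyChordTransferFibre3N1RowExprC
import Literature.MathematicalPhysics.QuantumLattice.HeisenbergOrderNeelRiemann3

/-!
# Route `AnisotropyChord` / H0 rotor rung, LEVEL 2 row `N₁`: the elementary SPEC FACTS of the staged box

For the soundness of `n1CellCheck` (`…N1RowCheckSound.n1CellCheck_sound`, hypothesis `hsp`) every staged coordinate of the true
profile must lie between the values of its two spec terms (`…N1RowExprC.specs`).  THIS FILE settles the purely trigonometric /
algebraic ones, as real inequalities plus the `RExpr.eval` bridges:
* `x₁₆ = ê₁ = (1 − cos θ)/θ² ∈ [½ − θ²/24, ½]` (`one_sub_cos_div_sq_bounds`), `x₁₈ = cos(θ/2) ∈ [1 − θ²/8, 1]`,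
  `cos(mθ) ∈ [1 − m²θ²/2, 1 − m²θ²/2 + m⁴θ⁴/24]`, `w_n = (1 − cos nθ)/θ² ∈ [n²/2 − n⁴θ²/24, n²/2]` (`|nθ| ≤ π`; from
  `two_mul_one_sub_cos_le_sq`, `sq_sub_quartic_le`, `cos_le_taylor_four`);
* the shifted energy `ε*`: `epsStarR`, its monotonicity in `E` (`epsStarR_mono`) and the KEY IDENTITY `rho_epsStarR`:
  `ρ(ε*(E)) = ρ(E) + aε/(2u)` (`ρ(e) = (2e − ν)/(2e − 4ν)`), whence `κ = 4c_suρ(x₁₇)` is the repaired slope `κ̂ + 2ac_s/V`;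
* `eval` bridges: `eval_e1Spec`, `eval_cosHalfSpec`, `eval_cosSpec`, `eval_wSpec`, `eval_epsStar`, `eval_emSpec`, and the spec
  memberships `e1Spec_holds`, `cosHalfSpec_holds`, `cosSpec_holds`, `wSpec_holds`, `emSpec_holds` for a vector carrying the true
  values.
The propagator block (`L2.ghat_bounds`) is already in `…Fibre3L2Block`; the tail block (`TtailBounds`) and the objects are the
physics layer `…N1RowExprSound`.
Prover seat `hubbard-h0-rotor-p2` g4; helper for piece A = stmt-HubbardSuperconductivity-23918 of rung 19089
(`--supports`, helper class).  Nothing here proves superconductivity in the Hubbard model; helper lemmas of ONE conditional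
reduction (the GM₃ ∀L certificate, Level-2 row `N₁`); the rotor TARGET as originally worded stays FALSE (g15 verdict).
Mathlib + the tree only; no sorry.
-/

set_option linter.dupNamespace false
set_option autoImplicit false

open Literature.Analysis.ValidatedNumerics

namespace Summit.HubbardSuperconductivity.HubbardSuperconductivity.Theorems.AnisotropyChord.Transfer.Fibre3.L2.N1

/-! ## Trigonometric boxes -/

/-- `u²/2 − u⁴/24 ≤ 1 − cos u ≤ u²/2` for `|u| ≤ π`. [folklore] -/
theorem one_sub_cos_bounds (u : ℝ) (hu : |u| ≤ Real.pi) :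
    u ^ 2 / 2 - u ^ 4 / 24 ≤ 1 - Real.cos u ∧ 1 - Real.cos u ≤ u ^ 2 / 2 := by
  have h1 := two_mul_one_sub_cos_le_sq u
  have h2 := sq_sub_quartic_le u hu
  constructor <;> linarith

/-- `m²θ²·(½ − m²θ²/24) ≤ 1 − cos(mθ) ≤ m²θ²/2`, divided form: for `θ > 0`, `|mθ| ≤ π`:
`m²/2 − m⁴θ²/24 ≤ (1 − cos(mθ))/θ² ≤ m²/2`. [folklore] -/
theorem one_sub_cos_div_sq_bounds (θ : ℝ) (hθ : 0 < θ) (m : ℝ) (hm : |m * θ| ≤ Real.pi) :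
    m ^ 2 / 2 - m ^ 4 * θ ^ 2 / 24 ≤ (1 - Real.cos (m * θ)) / θ ^ 2 ∧
      (1 - Real.cos (m * θ)) / θ ^ 2 ≤ m ^ 2 / 2 := by
  obtain ⟨h1, h2⟩ := one_sub_cos_bounds (m * θ) hm
  have hθ2 : 0 < θ ^ 2 := pow_pos hθ 2
  constructor
  · rw [le_div_iff₀ hθ2]
    have : (m ^ 2 / 2 - m ^ 4 * θ ^ 2 / 24) * θ ^ 2 = (m * θ) ^ 2 / 2 - (m * θ) ^ 4 / 24 := by ring
    rw [this]; exact h1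
  · rw [div_le_iff₀ hθ2]
    have : m ^ 2 / 2 * θ ^ 2 = (m * θ) ^ 2 / 2 := by ring
    rw [this]; exact h2

/-- `1 − m²θ²/2 ≤ cos(mθ) ≤ 1 − m²θ²/2 + m⁴θ⁴/24` (`|mθ| ≤ π`). [folklore] -/
theorem cos_mul_bounds (θ m : ℝ) (hm : |m * θ| ≤ Real.pi) :
    1 - m ^ 2 * θ ^ 2 / 2 ≤ Real.cos (m * θ) ∧ Real.cos (m * θ) ≤ 1 - m ^ 2 * θ ^ 2 / 2 + m ^ 4 * θ ^ 4 / 24 := by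
  obtain ⟨h1, h2⟩ := one_sub_cos_bounds (m * θ) hm
  constructor <;> nlinarith

/-- `1 − θ²/8 ≤ cos(θ/2) ≤ 1`. [folklore] -/
theorem cos_half_bounds (θ : ℝ) : 1 - θ ^ 2 / 8 ≤ Real.cos (θ / 2) ∧ Real.cos (θ / 2) ≤ 1 := by
  have h1 := two_mul_one_sub_cos_le_sq (θ / 2)
  constructor
  · nlinarith
  · exact Real.cos_le_one _

/-! ## The shifted energy `ε*` -/

/-- `ε*(E) = 2ν + (E − 2ν)/(1 + k(E − 2ν))`, `k = aε/(3νu)`. -/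
noncomputable def epsStarR (ν a ε u E : ℝ) : ℝ := 2 * ν + (E - 2 * ν) * (1 + a * ε * (3 * ν * u)⁻¹ * (E - 2 * ν))⁻¹

/-- `ε*` is monotone in `E` on `E ≥ 2ν` when `k ≥ 0`. [folklore] -/
theorem epsStarR_mono {ν a ε u E₁ E₂ : ℝ} (hk : 0 ≤ a * ε * (3 * ν * u)⁻¹) (h1 : 2 * ν ≤ E₁) (h12 : E₁ ≤ E₂) :
    epsStarR ν a ε u E₁ ≤ epsStarR ν a ε u E₂ := by
  unfold epsStarR
  set k := a * ε * (3 * ν * u)⁻¹ with hk_def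
  have hy1 : 0 ≤ E₁ - 2 * ν := by linarith
  have hy2 : 0 ≤ E₂ - 2 * ν := by linarith
  have hd1 : 0 < 1 + k * (E₁ - 2 * ν) := by nlinarith
  have hd2 : 0 < 1 + k * (E₂ - 2 * ν) := by nlinarith
  have : (E₁ - 2 * ν) * (1 + k * (E₁ - 2 * ν))⁻¹ ≤ (E₂ - 2 * ν) * (1 + k * (E₂ - 2 * ν))⁻¹ := by
    rw [← div_eq_mul_inv, ← div_eq_mul_inv, div_le_div_iff₀ hd1 hd2]
    nlinarith [mul_nonneg hk hy1, mul_nonneg hk hy2]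
  linarith

/-- ★ **THE SLOPE IDENTITY**: for `ν ≠ 0`, `u ≠ 0`, `E > 2ν` and `k = aε/(3νu) ≥ 0`:
`ρ(ε*(E)) = ρ(E) + aε/(2u)` with `ρ(e) = (2e − ν)(2e − 4ν)⁻¹`; hence `4c_suρ(ε*) = 4c_suρ(E) + 2ac_sε` (the repaired tail
slope `κ̂′ = κ̂ + 2ac_s/V`). [folklore] -/
theorem rho_epsStarR {ν a ε u E : ℝ} (hν : ν ≠ 0) (hu : u ≠ 0) (hE : 2 * ν < E) (hk : 0 ≤ a * ε * (3 * ν * u)⁻¹) :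
    (2 * epsStarR ν a ε u E - ν) * (2 * epsStarR ν a ε u E - 4 * ν)⁻¹
      = (2 * E - ν) * (2 * E - 4 * ν)⁻¹ + a * ε * (2 * u)⁻¹ := by
  unfold epsStarR
  set k := a * ε * (3 * ν * u)⁻¹ with hk_def
  have hy : 0 < E - 2 * ν := by linarith
  have hd : 0 < 1 + k * (E - 2 * ν) := by nlinarith
  have hk3 : k * (3 * ν * u) = a * ε := by
    rw [hk_def]; field_simp
  -- `2ε* − 4ν = 2y/(1+ky)`
  have e1 : 2 * (2 * ν + (E - 2 * ν) * (1 + k * (E - 2 * ν))⁻¹) - 4 * ν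
      = 2 * (E - 2 * ν) / (1 + k * (E - 2 * ν)) := by
    rw [← div_eq_mul_inv]; ring
  have e2 : 2 * (2 * ν + (E - 2 * ν) * (1 + k * (E - 2 * ν))⁻¹) - ν
      = (3 * ν * (1 + k * (E - 2 * ν)) + 2 * (E - 2 * ν)) / (1 + k * (E - 2 * ν)) := by
    rw [← div_eq_mul_inv]; field_simp; ring
  rw [e1, e2]
  have hE4 : 2 * E - 4 * ν ≠ 0 := by linarith
  have hy' : E - 2 * ν ≠ 0 := hy.ne'
  have hd' : 1 + k * (E - 2 * ν) ≠ 0 := hd.ne'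
  rw [← div_eq_mul_inv, ← div_eq_mul_inv, ← div_eq_mul_inv, div_div_div_cancel_right₀ hd']
  rw [div_add_div _ _ hE4 (by positivity : (2 : ℝ) * u ≠ 0), div_eq_div_iff (by positivity) (by positivity)]
  have : a * ε = k * (3 * ν * u) := hk3.symm
  rw [this]; ring

/-! ## `eval` bridges for the spec terms -/

/-- values of the `ê₁` spec. -/
theorem eval_e1Spec (x : ℕ → ℝ) :
    e1Spec.1.eval x = 1 / 2 - x 0 * (1 / 24) ∧ e1Spec.2.eval x = 1 / 2 := by
  simp only [e1Spec, RExpr.eval, cst, vT]; push_cast; exact ⟨by ring, by ring⟩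

/-- values of the `cos(θ/2)` spec. -/
theorem eval_cosHalfSpec (x : ℕ → ℝ) :
    cosHalfSpec.1.eval x = 1 - x 0 * (1 / 8) ∧ cosHalfSpec.2.eval x = 1 := by
  simp only [cosHalfSpec, RExpr.eval, cst, vT]; push_cast; exact ⟨by ring, by ring⟩

/-- values of the `cos(mθ)` spec. -/
theorem eval_cosSpec (x : ℕ → ℝ) (m : ℕ) :
    (cosSpec m).1.eval x = 1 - x 0 * ((m : ℝ) ^ 2 / 2) ∧
      (cosSpec m).2.eval x = 1 - x 0 * ((m : ℝ) ^ 2 / 2) + x 0 ^ 2 * ((m : ℝ) ^ 4 / 24) := by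
  simp only [cosSpec, RExpr.eval, cst, vT]; push_cast; exact ⟨by ring, by ring⟩

/-- values of the `w_n` spec. -/
theorem eval_wSpec (x : ℕ → ℝ) (n : ℕ) :
    (wSpec n).1.eval x = (n : ℝ) ^ 2 / 2 - x 0 * ((n : ℝ) ^ 4 / 24) ∧ (wSpec n).2.eval x = (n : ℝ) ^ 2 / 2 := by
  simp only [wSpec, RExpr.eval, cst, vT]; push_cast; exact ⟨by ring, by ring⟩

/-- value of `epsStar E`: `epsStarR (x₂) (x₃) (eps.eval x) (uu.eval x) (E.eval x)`. -/
theorem eval_epsStar (x : ℕ → ℝ) (E : RExpr) :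
    (epsStar E).eval x = epsStarR (x 2) (x 3) (eps.eval x) (uu.eval x) (E.eval x) := by
  simp only [epsStar, epsStarR, RExpr.eval, cst, vNu, vA]; push_cast; ring

/-- values of the two arguments of the `x₁₇` spec: `M²/2 − x₀M⁴/24` and `M²/2`. -/
theorem eval_emSpec_args (x : ℕ → ℝ) (M : ℕ) :
    (RExpr.sub (cst ((M : ℚ) ^ 2 / 2)) (.mul vT (cst ((M : ℚ) ^ 4 / 24)))).eval x = (M : ℝ) ^ 2 / 2 - x 0 * ((M : ℝ) ^ 4 / 24) ∧
      (cst ((M : ℚ) ^ 2 / 2)).eval x = (M : ℝ) ^ 2 / 2 := by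
  simp only [RExpr.eval, cst, vT]; push_cast; exact ⟨by ring, by ring⟩

/-! ## Spec memberships of a vector carrying the true values -/

/-- `ê₁`: if `x₀ = θ²` (`0 < θ ≤ π`) and `x₁₆ = (1 − cos θ)/θ²` then the `e1Spec` bracket holds. -/
theorem e1Spec_holds (x : ℕ → ℝ) (θ : ℝ) (hθ : 0 < θ) (hθπ : θ ≤ Real.pi) (h0 : x 0 = θ ^ 2)
    (h16 : x 16 = (1 - Real.cos θ) / θ ^ 2) :
    e1Spec.1.eval x ≤ x 16 ∧ x 16 ≤ e1Spec.2.eval x := by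
  obtain ⟨e1, e2⟩ := eval_e1Spec x
  have hb := one_sub_cos_div_sq_bounds θ hθ 1 (by rw [one_mul, abs_of_pos hθ]; exact hθπ)
  rw [one_mul] at hb
  rw [e1, e2, h16, h0]
  constructor <;> nlinarith [hb.1, hb.2]

/-- `cos(θ/2)`: if `x₀ = θ²` and `x₁₈ = cos(θ/2)` then the `cosHalfSpec` bracket holds. -/
theorem cosHalfSpec_holds (x : ℕ → ℝ) (θ : ℝ) (h0 : x 0 = θ ^ 2) (h18 : x 18 = Real.cos (θ / 2)) :
    cosHalfSpec.1.eval x ≤ x 18 ∧ x 18 ≤ cosHalfSpec.2.eval x := by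
  obtain ⟨e1, e2⟩ := eval_cosHalfSpec x
  have hb := cos_half_bounds θ
  rw [e1, e2, h18, h0]
  constructor <;> nlinarith [hb.1, hb.2]

/-- `cos(mθ)`: if `x₀ = θ²`, `|mθ| ≤ π` and `x_i = cos(mθ)` then the `cosSpec m` bracket holds at `i`. -/
theorem cosSpec_holds (x : ℕ → ℝ) (θ : ℝ) (m i : ℕ) (hm : |(m : ℝ) * θ| ≤ Real.pi) (h0 : x 0 = θ ^ 2)
    (hi : x i = Real.cos ((m : ℝ) * θ)) :
    (cosSpec m).1.eval x ≤ x i ∧ x i ≤ (cosSpec m).2.eval x := by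
  obtain ⟨e1, e2⟩ := eval_cosSpec x m
  have hb := cos_mul_bounds θ m hm
  rw [e1, e2, hi, h0]
  constructor <;> nlinarith [hb.1, hb.2]

/-- `w_n`: if `x₀ = θ²` (`θ > 0`), `|nθ| ≤ π` and `x_i = (1 − cos nθ)/θ²` then the `wSpec n` bracket holds at `i`. -/
theorem wSpec_holds (x : ℕ → ℝ) (θ : ℝ) (hθ : 0 < θ) (n i : ℕ) (hn : |(n : ℝ) * θ| ≤ Real.pi) (h0 : x 0 = θ ^ 2)
    (hi : x i = (1 - Real.cos ((n : ℝ) * θ)) / θ ^ 2) :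
    (wSpec n).1.eval x ≤ x i ∧ x i ≤ (wSpec n).2.eval x := by
  obtain ⟨e1, e2⟩ := eval_wSpec x n
  have hb := one_sub_cos_div_sq_bounds θ hθ n hn
  rw [e1, e2, hi, h0]
  constructor <;> nlinarith [hb.1, hb.2]

/-- `x₁₇ = ε*(ε̂_M)`: if `x₀ = θ²` (`θ > 0`, `|Mθ| ≤ π`), `k = x₃·ε/(3x₂u) ≥ 0` at `x`, `2x₂ ≤ M²/2 − θ²M⁴/24`, and
`x₁₇ = epsStarR x₂ x₃ ε u ((1 − cos Mθ)/θ²)` then the `emSpec M` bracket holds. -/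
theorem emSpec_holds (x : ℕ → ℝ) (θ : ℝ) (hθ : 0 < θ) (M : ℕ) (hM : |(M : ℝ) * θ| ≤ Real.pi) (h0 : x 0 = θ ^ 2)
    (hk : 0 ≤ x 3 * eps.eval x * (3 * x 2 * uu.eval x)⁻¹) (hν : 2 * x 2 ≤ (M : ℝ) ^ 2 / 2 - θ ^ 2 * ((M : ℝ) ^ 4 / 24))
    (h17 : x 17 = epsStarR (x 2) (x 3) (eps.eval x) (uu.eval x) ((1 - Real.cos ((M : ℝ) * θ)) / θ ^ 2)) :
    (emSpec M).1.eval x ≤ x 17 ∧ x 17 ≤ (emSpec M).2.eval x := by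
  unfold emSpec
  rw [eval_epsStar, eval_epsStar, (eval_emSpec_args x M).1, (eval_emSpec_args x M).2, h17, h0]
  have hb := one_sub_cos_div_sq_bounds θ hθ M hM
  constructor
  · apply epsStarR_mono hk (by linarith) (by linarith [hb.1])
  · apply epsStarR_mono hk (by linarith [hb.1]) hb.2

end Summit.HubbardSuperconductivity.HubbardSuperconductivity.Theorems.AnisotropyChord.Transfer.Fibre3.L2.N1
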